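import Summits.AtomisticToContinuum.Crystallization.Theorems.ReggeStarCoercivityDefectFreeCrystallizesAeMeckePricing
import Summits.AtomisticToContinuum.Crystallization.Theorems.ReggeStarCoercivityDefectFreeCrystallizesPalmDefs
import Summits.AtomisticToContinuum.Crystallization.Theorems.PalmUnimodularRigidityLayeredLawsSelectHcpDefs
import Literature.Probability.Process.PointStationaryLaw
import Literature.Geometry.DiscreteGeometry.KissingPatterns

/-!
# Route β of line `palm-good-law`: the CERTIFICATE ENTRY POINT for the funnel shell floor R2a″
# (crux `ReggeStarCoercivity.DefectFreeCrystallizes`, item stmt-AtomisticToContinuum-13603; lead c6, skeleton v19/v20)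

HOW A PROVER ATTACKS R2a″ (`…RouteBetaFloor.chartedFunnelToShells_of_funnelShellFloor`'s antecedent), kernel-checked: every
law-level structure input of R2a″ becomes a FREE TERM of a pointwise inequality on single rooted configurations —
* point-stationarity ⇒ the divergence `div t (μ) = ∫ (t μ y − t (θ_y μ) (−y)) dμ(y)` of any bounded finite-range jointly measurable
  bond transfer `t` has zero `P`-mean (Mecke pricing in a.s. form, `AeMeckePricing.stub_aeMeckePricing`, landed p136756);
* zero mean virial stress ⇒ the sitewise virial against any constant multiplier matrix `Λ` has zero `P`-mean (`integral_add_virial_eq`;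
  a Lagrange multiplier absorbing first-order AFFINE terms — the law-level form of "zero stress kills the affine part");
* a.s. force balance ⇒ the inequality is only needed on configurations in equilibrium at every point;
* the chart / everywhere-`SetGood` ⇒ only on charted funnel configurations.
Main result `funnelShellFloor_of_certificates`: R2a″ follows from FUNNEL CERTIFICATES `∃ κ > 0 ∀ δ > 0 ∀ ε > 0 ∃ (R, M, t)` with
`h(μ) + div t(μ) ≥ hcpE a₀ h₀ − ε` on every rooted `δ`-hard-core, charted-funnel, force-balanced `μ`, improved by `κ` when the root shell is
not `1 %`-good.  The `ε`-loss makes the family as weak as the floor in mean; `κ ≈ 1.4e-4` is the binding price per bad site (lead c6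
numbers, item evidence FUNNEL-BUDGET-c6.md).  All `[folklore]` bookkeeping; no new definitions.
-/

noncomputable section

open scoped ENNReal
open Filter Topology MeasureTheory

namespace Summit.AtomisticToContinuum.Crystallization.Theorems.PalmGoodLaw.RouteBetaCertificates

open Summit.AtomisticToContinuum.Crystallization.Theses
open Literature.MathematicalPhysics.StatisticalMechanics Literature.Geometry.DiscreteGeometry
open Literature.Probability.Process

/-- **The virial term has zero mean as soon as it is integrable enough to split** (bookkeeping): under zero mean virial stress,
`∫ (X μ + virial_Λ μ) dP = ∫ X dP` whenever both are integrable. [folklore] -/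
theorem integral_add_virial_eq {P : Measure (Measure (EuclideanSpace ℝ (Fin 3)))}
    (hZS : ∀ M : EuclideanSpace ℝ (Fin 3) →L[ℝ] EuclideanSpace ℝ (Fin 3),
      ∫ μ, (∫ y, deriv lennardJones ‖y‖ / ‖y‖ * inner ℝ y (M y) ∂μ) ∂P = 0)
    (Λ : EuclideanSpace ℝ (Fin 3) →L[ℝ] EuclideanSpace ℝ (Fin 3)) {X : Measure (EuclideanSpace ℝ (Fin 3)) → ℝ}
    (hX : Integrable X P)
    (hV : Integrable (fun μ => ∫ y, deriv lennardJones ‖y‖ / ‖y‖ * inner ℝ y (Λ y) ∂μ) P) :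
    ∫ μ, (X μ + ∫ y, deriv lennardJones ‖y‖ / ‖y‖ * inner ℝ y (Λ y) ∂μ) ∂P = ∫ μ, X μ ∂P := by
  rw [integral_add hX hV, hZS Λ, add_zero]

/-- **R2a″ FROM FUNNEL CERTIFICATES (sorry-free; the certificate family — the antecedent — is the prover's target).**  If for the relaxed reference `(a₀,h₀)` there is a price `κ > 0` such that for every hard core `δ > 0` and every
`ε > 0` some bounded finite-range jointly measurable bond transfer `t` certifies, on EVERY rooted `δ`-hard-core configuration that is
everywhere-`SetGood` and Barlow-charted and in force balance at every point, the pointwise inequality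
`hcpE a₀ h₀ − ε ≤ h(μ) + div t(μ)`, improved by `κ` when the root shell is not `1 %`-good, then R2a″ `stub_funnelShellFloor` holds:
Mecke pricing gives `hcpE a₀ h₀ − ε + κ·P*(bad) ≤ E_P[h] ≤ hcpE a₀ h₀`, so `P*(bad) ≤ ε/κ` for every `ε`, i.e. `P(bad) = 0`.
(The zero-mean-stress multiplier of the section docstring is available to a certificate prover through `integral_add_virial_eq`
once the virial is shown integrable on the law; it is not threaded through this statement to keep the stub signature that of the
landed all-configurations pricing lemma.) [folklore] -/
theorem funnelShellFloor_of_certificates :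
    (∀ a₀ h₀ : ℝ, 189 / 200 ≤ a₀ → a₀ ≤ 199 / 200 → 77 / 100 ≤ h₀ → h₀ ≤ 163 / 200 →
      (∀ a h : ℝ, 0 < a → 0 < h →
        Summit.AtomisticToContinuum.Crystallization.Theorems.PalmUnimodularRigidity.LayeredLawsSelectHcp.hcpE a₀ h₀ ≤
          Summit.AtomisticToContinuum.Crystallization.Theorems.PalmUnimodularRigidity.LayeredLawsSelectHcp.hcpE a h) →
      ∃ κ : ℝ, 0 < κ ∧ ∀ δ : ℝ, 0 < δ → ∀ ε : ℝ, 0 < ε →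
        ∃ R M : ℝ, ∃ t : Measure (EuclideanSpace ℝ (Fin 3)) → EuclideanSpace ℝ (Fin 3) → ℝ,
          (Measurable (Function.uncurry t) ∧ (∀ μ y, |t μ y| ≤ M) ∧ ∀ μ y, R < ‖y‖ → t μ y = 0) ∧
          ∀ μ : Measure (EuclideanSpace ℝ (Fin 3)), IsRootedHardCore δ μ →
            (∃ S : Set (EuclideanSpace ℝ (Fin 3)),
              μ = (Measure.count : Measure (EuclideanSpace ℝ (Fin 3))).restrict S ∧
              (∀ y ∈ S, SetGood S y) ∧
              ∃ s : ℤ → ℤ, IsHaggSeq s ∧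
                ∃ Φ : EuclideanSpace ℝ (Fin 3) → EuclideanSpace ℝ (Fin 3),
                  Set.BijOn Φ (barlowStacking 1 (Real.sqrt (2 / 3)) s) S ∧
                  ∀ p ∈ barlowStacking 1 (Real.sqrt (2 / 3)) s, ∀ q ∈ barlowStacking 1 (Real.sqrt (2 / 3)) s,
                    (dist p q = 1 ↔ (0 < dist (Φ p) (Φ q) ∧ dist (Φ p) (Φ q) < 6 / 5))) →
            (∃ S : Set (EuclideanSpace ℝ (Fin 3)),
              μ = (Measure.count : Measure (EuclideanSpace ℝ (Fin 3))).restrict S ∧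
              ∀ p ∈ S, HasSum (fun q : {q : EuclideanSpace ℝ (Fin 3) // q ∈ S ∧ q ≠ p} =>
                (deriv lennardJones (dist p q.1) / dist p q.1) • (p - q.1)) 0) →
            (Summit.AtomisticToContinuum.Crystallization.Theorems.PalmUnimodularRigidity.LayeredLawsSelectHcp.hcpE a₀ h₀ - ε ≤
                (∫ y, lennardJones ‖y‖ ∂μ) / 2 + ∫ y, (t μ y - t (Measure.map (fun z => z - y) μ) (-y)) ∂μ) ∧
            ((¬ ∃ a : ℝ, 9 / 10 ≤ a ∧ a ≤ 1 ∧ ∃ T : Finset (EuclideanSpace ℝ (Fin 3)),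
                (↑T : Set (EuclideanSpace ℝ (Fin 3))) =
                  {y : EuclideanSpace ℝ (Fin 3) | μ {y} ≠ 0 ∧ y ≠ 0 ∧ ‖y‖ ≤ 5 / 4 * a} ∧
                (ShellCloseTo (a / 100) T (Finset.image (fun v : EuclideanSpace ℝ (Fin 3) => a • v) fccKissingPattern) ∨
                  ShellCloseTo (a / 100) T (Finset.image (fun v : EuclideanSpace ℝ (Fin 3) => a • v) hcpKissingPattern))) →
              Summit.AtomisticToContinuum.Crystallization.Theorems.PalmUnimodularRigidity.LayeredLawsSelectHcp.hcpE a₀ h₀ - ε + κ ≤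
                (∫ y, lennardJones ‖y‖ ∂μ) / 2 + ∫ y, (t μ y - t (Measure.map (fun z => z - y) μ) (-y)) ∂μ)) →
    ∀ a₀ h₀ : ℝ, 189 / 200 ≤ a₀ → a₀ ≤ 199 / 200 → 77 / 100 ≤ h₀ → h₀ ≤ 163 / 200 →
      (∀ a h : ℝ, 0 < a → 0 < h →
        Summit.AtomisticToContinuum.Crystallization.Theorems.PalmUnimodularRigidity.LayeredLawsSelectHcp.hcpE a₀ h₀ ≤
          Summit.AtomisticToContinuum.Crystallization.Theorems.PalmUnimodularRigidity.LayeredLawsSelectHcp.hcpE a h) →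
      ∀ δ : ℝ, 0 < δ → ∀ P : Measure (Measure (EuclideanSpace ℝ (Fin 3))), IsProbabilityMeasure P →
        (∀ᵐ μ ∂P, IsRootedHardCore δ μ) → IsPointStationaryLaw P →
        (∀ᵐ μ ∂P, ∃ S : Set (EuclideanSpace ℝ (Fin 3)),
          μ = (Measure.count : Measure (EuclideanSpace ℝ (Fin 3))).restrict S ∧
          (∀ y ∈ S, SetGood S y) ∧
          ∃ s : ℤ → ℤ, IsHaggSeq s ∧
            ∃ Φ : EuclideanSpace ℝ (Fin 3) → EuclideanSpace ℝ (Fin 3),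
              Set.BijOn Φ (barlowStacking 1 (Real.sqrt (2 / 3)) s) S ∧
              ∀ p ∈ barlowStacking 1 (Real.sqrt (2 / 3)) s, ∀ q ∈ barlowStacking 1 (Real.sqrt (2 / 3)) s,
                (dist p q = 1 ↔ (0 < dist (Φ p) (Φ q) ∧ dist (Φ p) (Φ q) < 6 / 5))) →
        (∀ᵐ μ ∂P, ∃ S : Set (EuclideanSpace ℝ (Fin 3)),
          μ = (Measure.count : Measure (EuclideanSpace ℝ (Fin 3))).restrict S ∧
          ∀ p ∈ S, HasSum (fun q : {q : EuclideanSpace ℝ (Fin 3) // q ∈ S ∧ q ≠ p} =>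
            (deriv lennardJones (dist p q.1) / dist p q.1) • (p - q.1)) 0) →
        (∀ M : EuclideanSpace ℝ (Fin 3) →L[ℝ] EuclideanSpace ℝ (Fin 3),
          ∫ μ, (∫ y, deriv lennardJones ‖y‖ / ‖y‖ * inner ℝ y (M y) ∂μ) ∂P = 0) →
        (∫ μ, (∫ y, lennardJones ‖y‖ ∂μ) / 2 ∂P) ≤
          Summit.AtomisticToContinuum.Crystallization.Theorems.PalmUnimodularRigidity.LayeredLawsSelectHcp.hcpE a₀ h₀ →
        ∀ᵐ μ ∂P, ∃ a : ℝ, 9 / 10 ≤ a ∧ a ≤ 1 ∧ ∃ T : Finset (EuclideanSpace ℝ (Fin 3)),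
          (↑T : Set (EuclideanSpace ℝ (Fin 3))) =
            {y : EuclideanSpace ℝ (Fin 3) | μ {y} ≠ 0 ∧ y ≠ 0 ∧ ‖y‖ ≤ 5 / 4 * a} ∧
          (ShellCloseTo (a / 100) T (Finset.image (fun v : EuclideanSpace ℝ (Fin 3) => a • v) fccKissingPattern) ∨
            ShellCloseTo (a / 100) T (Finset.image (fun v : EuclideanSpace ℝ (Fin 3) => a • v) hcpKissingPattern)) := by
  intro hcert a₀ h₀ ha₁ ha₂ hh₁ hh₂ hmin δ hδ P hP hcore hstat hchart hFB _hZS hlevel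
  obtain ⟨κ, hκ, hcertδ⟩ := hcert a₀ h₀ ha₁ ha₂ hh₁ hh₂ hmin
  -- name the conclusion predicate
  set G : Measure (EuclideanSpace ℝ (Fin 3)) → Prop := fun μ => ∃ a : ℝ, 9 / 10 ≤ a ∧ a ≤ 1 ∧
      ∃ T : Finset (EuclideanSpace ℝ (Fin 3)),
        (↑T : Set (EuclideanSpace ℝ (Fin 3))) =
          {y : EuclideanSpace ℝ (Fin 3) | μ {y} ≠ 0 ∧ y ≠ 0 ∧ ‖y‖ ≤ 5 / 4 * a} ∧
        (ShellCloseTo (a / 100) T (Finset.image (fun v : EuclideanSpace ℝ (Fin 3) => a • v) fccKissingPattern) ∨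
          ShellCloseTo (a / 100) T (Finset.image (fun v : EuclideanSpace ℝ (Fin 3) => a • v) hcpKissingPattern))
    with hG
  -- for every ε, the bad event has outer probability ≤ ε / κ
  have hb : ∀ ε : ℝ, 0 < ε → κ * (P {μ | ¬ G μ}).toReal ≤ ε := by
    intro ε hε
    obtain ⟨R, M, t, ht, hpt⟩ := hcertδ δ hδ ε hε
    have hae : ∀ᵐ μ ∂P,
        (Summit.AtomisticToContinuum.Crystallization.Theorems.PalmUnimodularRigidity.LayeredLawsSelectHcp.hcpE a₀ h₀ - ε ≤
            (∫ y, lennardJones ‖y‖ ∂μ) / 2 + ∫ y, (t μ y - t (Measure.map (fun z => z - y) μ) (-y)) ∂μ) ∧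
        (¬ G μ →
          Summit.AtomisticToContinuum.Crystallization.Theorems.PalmUnimodularRigidity.LayeredLawsSelectHcp.hcpE a₀ h₀ - ε + κ ≤
            (∫ y, lennardJones ‖y‖ ∂μ) / 2 + ∫ y, (t μ y - t (Measure.map (fun z => z - y) μ) (-y)) ∂μ) := by
      filter_upwards [hcore, hchart, hFB] with μ hc hch hfb
      exact hpt μ hc hch hfb
    have hprice := AeMeckePricing.stub_aeMeckePricing δ hδ P hP hcore hstat R M t ht G _ κ hκ.le hae
    linarith
  -- hence it is null
  have hfin : P {μ | ¬ G μ} ≠ ⊤ := measure_ne_top P _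
  have h0 : (P {μ | ¬ G μ}).toReal = 0 := by
    refine le_antisymm ?_ ENNReal.toReal_nonneg
    by_contra hpos
    rw [not_le] at hpos
    have := hb (κ * (P {μ | ¬ G μ}).toReal / 2) (by positivity)
    nlinarith
  have hnull : P {μ | ¬ G μ} = 0 := by
    rcases (ENNReal.toReal_eq_zero_iff _).1 h0 with h | h
    · exact h
    · exact absurd h hfin
  exact ae_iff.2 hnull


end Summit.AtomisticToContinuum.Crystallization.Theorems.PalmGoodLaw.RouteBetaCertificates

end
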